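import Summits.Ventures.HodgeRepro2.T5SU11QuotientIntegral
import Summits.Ventures.HodgeRepro2.T5SU11CoefficientL2

/-!
# The orbit map pushes the Haar measure to the Poincaré measure: `orbit_* ν = μ_K(K) · poincare`

The Haar measure `ν = Φ_*(poincare ⊗ μ_K)` of `T5SU11FibrationHaar` and the orbit map `g ↦ g·0`
satisfy `orbit ∘ Φ = fst` `poincare ⊗ μ_K`-almost everywhere, hence
**`orbit_* ν = μ_K(K) • poincare`** (`map_orbit_nu`) — the Poincaré measure of the disc IS the
quotient measure of the Haar measure by `K`, in measure form; for Rühl's measure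
`orbit_* μ_R = π⁻¹ • poincare` (`map_orbit_ruhl`). Consequences: for EVERY a.e.-strongly measurable
`F : ℂ → E` (no integrability hypothesis), `∫_G F(g·0) dν = μ_K(K) • ∫_𝔻 F dpoincare`
(`integral_nu_comp_orbit_of_aestronglyMeasurable`, sharpening `T5SU11QuotientIntegral`), the same
for the inverse orbit `g ↦ g⁻¹·0` by the inversion invariance of `ν` (`map_orbit_inv_nu`,
`integral_nu_comp_orbit_inv`), and a LEFT-`K`-invariant function is a function of `g⁻¹·0`
(`left_rot_invariant_eq`: `f g = f (s(g⁻¹·0)⁻¹)`) with `∫_G f dν = μ_K(K) • ∫_𝔻 f(s(z)⁻¹) dpoincare`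
(`integral_nu_of_left_rot_invariant`). Nothing is claimed about (N).

Blind lane: Mathlib + the HodgeRepro2 prefix only; no sorry; axioms ⊆ {propext, Classical.choice,
Quot.sound}.
-/

namespace Summit.Ventures.HodgeRepro2.T5SU11OrbitMeasure

open MeasureTheory MeasureTheory.Measure Metric Set Filter Topology Complex
open T5PoincareDensity T5PoincareInvariance T5PoincareMeasure T5SU11Unimodular T5SU11Fibration
  T5SU11FibrationHaar T5SU11Cartan T5SU11OneParameter T5BergmanCoefficient T5SU11FibrationCocycle
  T5SU11QuotientIntegral T5HaarCircle T5SU11CoefficientL2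
open scoped ENNReal NNReal Real

section measure

variable [MeasurableSpace Circle] [BorelSpace Circle] (μC : Measure Circle) [IsHaarMeasure μC]

omit [BorelSpace Circle] in
/-- `orbit ∘ Φ = fst` almost everywhere for `poincare ⊗ μ_K` (the complement of the disc is
`poincare`-null). -/
lemma orbit_comp_fib_ae_eq_fst :
    (orbit ∘ fib) =ᵐ[poincare.prod μC] (Prod.fst : ℂ × Circle → ℂ) := by
  have hnull : (poincare.prod μC) ((ball (0 : ℂ) 1)ᶜ ×ˢ (Set.univ : Set Circle)) = 0 := by
    rw [Measure.prod_prod, poincare_compl_ball, zero_mul]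
  rw [Filter.EventuallyEq, ae_iff]
  apply measure_mono_null _ hnull
  intro p hp
  simp only [Set.mem_setOf_eq] at hp
  refine ⟨?_, Set.mem_univ _⟩
  intro hball
  exact hp (by rw [Function.comp_apply, show fib p = fib (p.1, p.2) from rfl, orbit_fib hball])

/-- **The orbit map pushes the Haar measure to the Poincaré measure**:
`orbit_* ν = μ_K(K) • poincare`. -/
theorem map_orbit_nu : Measure.map orbit (nu μC) = μC Set.univ • poincare := by
  rw [show nu μC = Measure.map fib (poincare.prod μC) from rfl,
    Measure.map_map continuous_orbit.measurable measurable_fib,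
    Measure.map_congr (orbit_comp_fib_ae_eq_fst μC), Measure.map_fst_prod]

/-- **The orbit of the inverse pushes the Haar measure to the Poincaré measure as well**:
`(g ↦ g⁻¹·0)_* ν = μ_K(K) • poincare` (`ν` is inversion invariant — `SU(1,1)` is unimodular). -/
theorem map_orbit_inv_nu : Measure.map (fun g : SU11 => orbit g⁻¹) (nu μC) = μC Set.univ • poincare := by
  haveI : IsInvInvariant (nu μC) := isInvInvariant (nu μC)
  have h : (fun g : SU11 => orbit g⁻¹) = orbit ∘ Inv.inv := rfl
  rw [h, ← Measure.map_map continuous_orbit.measurable measurable_inv, map_inv_eq_self, map_orbit_nu]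

/-- **`∫_G F(g·0) dν = μ_K(K) • ∫_𝔻 F dpoincare`** for EVERY a.e.-strongly measurable `F`
(no integrability hypothesis). -/
theorem integral_nu_comp_orbit_of_aestronglyMeasurable {E : Type*} [NormedAddCommGroup E]
    [NormedSpace ℝ E] (F : ℂ → E) (hF : AEStronglyMeasurable F poincare) :
    ∫ g, F (orbit g) ∂(nu μC) = (μC Set.univ).toReal • ∫ z, F z ∂poincare := by
  have hF' : AEStronglyMeasurable F (Measure.map orbit (nu μC)) := by
    rw [map_orbit_nu]
    exact hF.smul_measure _
  rw [← integral_map continuous_orbit.measurable.aemeasurable hF', map_orbit_nu,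
    integral_smul_measure]

/-- **`∫_G F(g⁻¹·0) dν = μ_K(K) • ∫_𝔻 F dpoincare`** for every a.e.-strongly measurable `F`. -/
theorem integral_nu_comp_orbit_inv {E : Type*} [NormedAddCommGroup E] [NormedSpace ℝ E]
    (F : ℂ → E) (hF : AEStronglyMeasurable F poincare) :
    ∫ g, F (orbit g⁻¹) ∂(nu μC) = (μC Set.univ).toReal • ∫ z, F z ∂poincare := by
  have hF' : AEStronglyMeasurable F (Measure.map (fun g : SU11 => orbit g⁻¹) (nu μC)) := by
    rw [map_orbit_inv_nu]
    exact hF.smul_measure _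
  have hm : Measurable (fun g : SU11 => orbit g⁻¹) := (continuous_orbit.comp continuous_inv).measurable
  rw [← integral_map hm.aemeasurable hF', map_orbit_inv_nu, integral_smul_measure]

/-- **Rühl's measure pushes to `π⁻¹ • poincare`**: `orbit_* μ_R = π⁻¹ • poincare`. -/
theorem map_orbit_ruhl : Measure.map orbit ruhl = ENNReal.ofReal π⁻¹ • poincare := by
  rw [ruhl, Measure.map_smul, map_orbit_nu, haarCircle_univ, one_smul]

end measure

/-! ### Left-`K`-invariant functions are functions of `g⁻¹·0` -/

/-- A left-`K`-invariant function is determined by its values on the inverses of the section: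
`f g = f (s(g⁻¹·0)⁻¹)`. -/
theorem left_rot_invariant_eq {E : Type*} (f : SU11 → E) (hf : ∀ u g, f (rot u * g) = f g)
    (g : SU11) : f g = f (sec (orbit g⁻¹))⁻¹ := by
  have h : g = rot (phase (mat g⁻¹ 0 0))⁻¹ * (sec (orbit g⁻¹))⁻¹ := by
    conv_lhs => rw [← inv_inv g, eq_sec_orbit_mul_rot g⁻¹]
    rw [mul_inv_rev, map_inv]
  conv_lhs => rw [h]
  exact hf _ _

section measure2

variable [MeasurableSpace Circle] [BorelSpace Circle] (μC : Measure Circle) [IsHaarMeasure μC]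

/-- **A left-`K`-invariant function integrates over the disc**:
`∫_G f dν = μ_K(K) • ∫_𝔻 f(s(z)⁻¹) dpoincare(z)` for a.e.-strongly measurable left-`K`-invariant `f`. -/
theorem integral_nu_of_left_rot_invariant {E : Type*} [NormedAddCommGroup E] [NormedSpace ℝ E]
    (f : SU11 → E) (hf : AEStronglyMeasurable (fun z => f (sec z)⁻¹) poincare)
    (hK : ∀ u g, f (rot u * g) = f g) :
    ∫ g, f g ∂(nu μC) = (μC Set.univ).toReal • ∫ z, f (sec z)⁻¹ ∂poincare := by
  rw [← integral_nu_comp_orbit_inv μC (fun z => f (sec z)⁻¹) hf]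
  exact integral_congr_ae (Filter.Eventually.of_forall fun g => left_rot_invariant_eq f hK g)

end measure2

end Summit.Ventures.HodgeRepro2.T5SU11OrbitMeasure
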